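import Literature.NumberTheory.Sieve.QuadraticRootsLevelClasses
import Literature.NumberTheory.Sieve.QuadraticRootsLevelCosets
import Mathlib.GroupTheory.Index
import HarnessLib

/-!
# Level classes of a form: stabilisers at level `q` and the total index `O(τ(q))` (any sign)

Topic `Literature/NumberTheory/Sieve`, fifth file of the arithmetic trunk common to W. Duke,
J. B. Friedlander, H. Iwaniec, Ann. of Math. 141 (1995), §2 and Á. Tóth, IMRN 2000
(`QuadraticRootsLevelForms.lean`, `…LevelCosets.lean`, `…LevelClasses.lean`,
`…LevelGeometry.lean`).  The level forms in the `SL₂(ℤ)`-class of a form `R` fall into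
`Γ₀(q)`-classes; these are the orbits of the stabiliser `stab R` (DFI's `Γ_z`) acting by left
multiplication on the level cosets `ξΓ₀(q)` of `QuadraticRootsLevelCosets.lean`, and the
`Γ₀(q)`-stabiliser of the form `R·ξ` is the *level stabiliser* `stab (R·ξ) ⊓ Γ₀(q)`.  For
`Δ < 0` all these groups are finite (DFI normalise by `|Γ_z|`); for `Δ > 0` (Tóth) `stab` is
infinite cyclic up to sign and the index `[stab (R·ξ) : stab (R·ξ) ⊓ Γ₀(q)]` is the number of
primitive periods of the closed geodesic of `R·ξ` on `Γ₀(q)∖ℍ`.  This file proves, for every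
integral form `R` with `A ≠ 0` and non-square discriminant:

* `RootForms.stabLevel Q q = stab Q ⊓ Γ₀(q)` and `relIndex_stabLevel_le`: its index in `stab Q`
  is at most `[SL₂(ℤ) : Γ₀(q)]` (finite);
* `RootForms.mem_stabilizer_coset_iff` / `index_stabilizer_coset`: the stabiliser in `stab R` of the
  coset `ξΓ₀(q)` is carried by `s ↦ ξ⁻¹sξ` onto `stabLevel (R·ξ) q`, so that
  **`[stab (R·ξ) : stabLevel (R·ξ) q] = #(orbit of ξΓ₀(q) under stab R)`** (orbit–stabiliser,
  `MulAction.index_stabilizer`);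
* **`RootForms.exists_sum_relIndex_le`** — the total index over inequivalent level classes is
  `O(τ(q))`: there is `C = C(R)` such that for every `q ≥ 1` and every finite set of matrices `ξ`
  with `q ∣ (R·ξ).a`, pairwise in different `stab R`-orbits of level cosets,
  `∑_ξ [stab (R·ξ) : stabLevel (R·ξ) q] ≤ C τ(q)` (the orbits are disjoint subsets of the level
  cosets, counted by `exists_card_levelCosets_le`).  For `Δ > 0` this bounds the total length of
  the closed geodesics carrying the level-`q` forms of a class by `O_R(τ(q))`; for `Δ < 0` it
  re-proves the `O(τ(q))` count of points.

Everything here is proved; nothing of either paper is vendored.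

## References

* W. Duke, J. B. Friedlander, H. Iwaniec, Ann. of Math. (2) 141 (1995), 423–441, §2 p. 428 (the
  classes at level `q = ad`, the `O(τ(q))` remark after (14)). [cite: DukeFriedlanderIwaniec1995, §2 p. 428]
* Á. Tóth, *Roots of quadratic congruences*, IMRN 2000, no. 14, 719–739 (positive discriminant:
  closed geodesics on `Γ₀(q)∖ℍ`; cite-only in the store, cf. [cite: Ngo2024, §1]).
  [cite: Toth2000, main theorem]
-/

noncomputable section

namespace Literature.NumberTheory.Sieve

open scoped MatrixGroups
open Literature.NumberTheory.QuadraticFields.Quadratic (BinQF)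

namespace RootForms

variable {q : ℕ}

/-! ### Level stabilisers -/

/-- The **level stabiliser** `stab_q(Q) = stab Q ⊓ Γ₀(q)`: the `Γ₀(q)`-automorphs of `Q` (for
`Δ > 0` the deck group of the closed geodesic of `Q` on `Γ₀(q)∖ℍ`).
[cite: DukeFriedlanderIwaniec1995, §2 p. 428] -/
def stabLevel (Q : BinQF) (q : ℕ) : Subgroup SL(2, ℤ) := stab Q ⊓ CongruenceSubgroup.Gamma0 q

/-- Membership in the level stabiliser. [folklore] -/
theorem mem_stabLevel_iff {Q : BinQF} {s : SL(2, ℤ)} :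
    s ∈ stabLevel Q q ↔ s ∈ stab Q ∧ s ∈ CongruenceSubgroup.Gamma0 q := Iff.rfl

/-- `stab_q(Q) ≤ stab Q`. [folklore] -/
theorem stabLevel_le (Q : BinQF) (q : ℕ) : stabLevel Q q ≤ stab Q := inf_le_left

/-- The index `[stab Q : stab_q(Q)]` equals the relative index of `Γ₀(q)` in `stab Q`. [folklore] -/
theorem relIndex_stabLevel (Q : BinQF) (q : ℕ) :
    (stabLevel Q q).relIndex (stab Q) = (CongruenceSubgroup.Gamma0 q).relIndex (stab Q) := by
  rw [stabLevel, inf_comm, Subgroup.inf_relIndex_right]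

/-- **`[stab Q : stab_q(Q)] ≤ [SL₂(ℤ) : Γ₀(q)]`**, in particular it is finite and non-zero for
`q ≥ 1`. [folklore] -/
theorem relIndex_stabLevel_le (Q : BinQF) (q : ℕ) [NeZero q] :
    (stabLevel Q q).relIndex (stab Q) ≤ (CongruenceSubgroup.Gamma0 q).index ∧
      (stabLevel Q q).relIndex (stab Q) ≠ 0 := by
  rw [relIndex_stabLevel]
  have hne : (CongruenceSubgroup.Gamma0 q).index ≠ 0 := Subgroup.FiniteIndex.index_ne_zero
  have h1 : (CongruenceSubgroup.Gamma0 q).relIndex (stab Q) ≠ 0 := by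
    have := Subgroup.relIndex_top_right (CongruenceSubgroup.Gamma0 q)
    refine fun h0 => hne ?_
    rw [← Subgroup.relIndex_top_right]
    exact Subgroup.relIndex_eq_zero_of_le_right le_top (by rw [h0])
  refine ⟨?_, h1⟩
  rw [← Subgroup.relIndex_top_right]
  exact Subgroup.relIndex_le_of_le_right le_top (by rwa [Subgroup.relIndex_top_right])

/-! ### The action of `stab R` on the level cosets -/

/-- `stab R` acts on `SL₂(ℤ)∕Γ₀(q)` by left multiplication; the stabiliser of the coset `ξΓ₀(q)`
consists of the `s ∈ stab R` with `ξ⁻¹ s ξ ∈ Γ₀(q)`. [folklore] -/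
theorem mem_stabilizer_coset_iff (R : BinQF) (ξ : SL(2, ℤ)) (s : stab R) :
    s ∈ MulAction.stabilizer (stab R) ((ξ : SL(2, ℤ)) : SL(2, ℤ) ⧸ CongruenceSubgroup.Gamma0 q) ↔
      ξ⁻¹ * (s : SL(2, ℤ)) * ξ ∈ CongruenceSubgroup.Gamma0 q := by
  rw [MulAction.mem_stabilizer_iff]
  change ((((s : SL(2, ℤ)) * ξ : SL(2, ℤ)) : SL(2, ℤ) ⧸ CongruenceSubgroup.Gamma0 q) = _) ↔ _
  rw [QuotientGroup.eq]
  rw [show ((s : SL(2, ℤ)) * ξ)⁻¹ * ξ = (ξ⁻¹ * (s : SL(2, ℤ)) * ξ)⁻¹ by group]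
  exact Subgroup.inv_mem_iff _

/-- Conjugation `s ↦ ξ⁻¹ s ξ` is an isomorphism `stab R ≃* stab (R·ξ)`. [folklore] -/
def stabConj (R : BinQF) (ξ : SL(2, ℤ)) : stab R ≃* stab (smul R ξ) where
  toFun s := ⟨ξ⁻¹ * (s : SL(2, ℤ)) * ξ, by
    rw [mem_stab_smul_iff]
    rw [show ξ * (ξ⁻¹ * (s : SL(2, ℤ)) * ξ) * ξ⁻¹ = (s : SL(2, ℤ)) by group]
    exact s.2⟩
  invFun t := ⟨ξ * (t : SL(2, ℤ)) * ξ⁻¹, mem_stab_smul_iff.1 t.2⟩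
  left_inv s := by
    apply Subtype.ext
    show ξ * (ξ⁻¹ * (s : SL(2, ℤ)) * ξ) * ξ⁻¹ = s
    group
  right_inv t := by
    apply Subtype.ext
    show ξ⁻¹ * (ξ * (t : SL(2, ℤ)) * ξ⁻¹) * ξ = t
    group
  map_mul' s s' := by
    apply Subtype.ext
    show ξ⁻¹ * ((s : SL(2, ℤ)) * s') * ξ = (ξ⁻¹ * (s : SL(2, ℤ)) * ξ) * (ξ⁻¹ * (s' : SL(2, ℤ)) * ξ)
    group

/-- The underlying matrix of `stabConj R ξ s` is `ξ⁻¹ s ξ`. [folklore] -/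
@[simp] theorem coe_stabConj (R : BinQF) (ξ : SL(2, ℤ)) (s : stab R) :
    ((stabConj R ξ s : stab (smul R ξ)) : SL(2, ℤ)) = ξ⁻¹ * (s : SL(2, ℤ)) * ξ := rfl

/-- Under `stabConj`, the stabiliser of the coset `ξΓ₀(q)` is the level stabiliser of `R·ξ`
(pulled back to `stab (R·ξ)`). [folklore] -/
theorem stabilizer_coset_eq_comap (R : BinQF) (ξ : SL(2, ℤ)) :
    MulAction.stabilizer (stab R) ((ξ : SL(2, ℤ)) : SL(2, ℤ) ⧸ CongruenceSubgroup.Gamma0 q) =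
      (((stabLevel (smul R ξ) q).subgroupOf (stab (smul R ξ))).comap
        (stabConj R ξ).toMonoidHom) := by
  ext s
  rw [mem_stabilizer_coset_iff, Subgroup.mem_comap, Subgroup.mem_subgroupOf, mem_stabLevel_iff]
  simp only [MulEquiv.coe_toMonoidHom, coe_stabConj]
  exact ⟨fun h => ⟨(stabConj R ξ s).2, h⟩, fun h => h.2⟩

/-- **Orbit–stabiliser at level `q`**: `[stab (R·ξ) : stab_q(R·ξ)]` is the number of level cosets in
the `stab R`-orbit of `ξΓ₀(q)`, i.e. the number of cosets of `SL₂(ℤ)∕Γ₀(q)` glued into the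
`Γ₀(q)`-class of `R·ξ` (for `Δ > 0`: the number of primitive periods of its closed geodesic on
`Γ₀(q)∖ℍ`). [cite: DukeFriedlanderIwaniec1995, §2 p. 428] -/
theorem index_stabilizer_coset (R : BinQF) (ξ : SL(2, ℤ)) :
    (stabLevel (smul R ξ) q).relIndex (stab (smul R ξ)) =
      (MulAction.orbit (stab R) ((ξ : SL(2, ℤ)) : SL(2, ℤ) ⧸ CongruenceSubgroup.Gamma0 q)).ncard := by
  calc (stabLevel (smul R ξ) q).relIndex (stab (smul R ξ))
      = ((stabLevel (smul R ξ) q).subgroupOf (stab (smul R ξ))).index := rfl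
    _ = (((stabLevel (smul R ξ) q).subgroupOf (stab (smul R ξ))).comap
          (stabConj R ξ).toMonoidHom).index :=
        (Subgroup.index_comap_of_surjective
          ((stabLevel (smul R ξ) q).subgroupOf (stab (smul R ξ)))
          (f := (stabConj R ξ).toMonoidHom) (stabConj R ξ).surjective).symm
    _ = (MulAction.stabilizer (stab R)
          ((ξ : SL(2, ℤ)) : SL(2, ℤ) ⧸ CongruenceSubgroup.Gamma0 q)).index := by
        rw [stabilizer_coset_eq_comap]
    _ = _ := MulAction.index_stabilizer _ _

/-- The `stab R`-orbit of a level coset consists of level cosets (`R·(sξ) = R·ξ`).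
[cite: DukeFriedlanderIwaniec1995, §2 p. 428] -/
theorem orbit_subset_levelCosets (R : BinQF) {ξ : SL(2, ℤ)} (hξ : (q : ℤ) ∣ (smul R ξ).a) :
    MulAction.orbit (stab R) ((ξ : SL(2, ℤ)) : SL(2, ℤ) ⧸ CongruenceSubgroup.Gamma0 q) ⊆
      {x | IsLevelCoset R q x} := by
  rintro x ⟨s, rfl⟩
  change IsLevelCoset R q ((((s : SL(2, ℤ)) * ξ : SL(2, ℤ)) : SL(2, ℤ) ⧸ CongruenceSubgroup.Gamma0 q))
  rw [isLevelCoset_mk_iff, smul_mul, mem_stab_iff.1 s.2]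
  exact hξ

/-! ### The total index over inequivalent level classes is `O(τ(q))` -/

/-- **Total index bound.**  For `R = [A, B, C]` with `A ≠ 0` and non-square discriminant there is
`C = C(R)` such that for every `q ≥ 1` and every finite set `S` of matrices `ξ` with
`q ∣ (R·ξ).a` whose level cosets `ξΓ₀(q)` lie in pairwise distinct `stab R`-orbits (i.e. the forms
`R·ξ`, `ξ ∈ S`, represent distinct `Γ₀(q)`-classes), `∑_{ξ ∈ S} [stab (R·ξ) : stab_q(R·ξ)] ≤ C τ(q)`.
(The orbits are disjoint subsets of the level cosets; `exists_card_levelCosets_le`.)  For `Δ > 0`: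
the closed geodesics on `Γ₀(q)∖ℍ` carrying the level-`q` forms of the class of `R` have total
length `O_R(τ(q))`. [cite: DukeFriedlanderIwaniec1995, §2 p. 428 (the `O(τ(q))` remark, level-class form)] -/
theorem exists_sum_relIndex_le (R : BinQF) (hA : R.a ≠ 0) (hΔ : ¬ IsSquare R.disc) :
    ∃ C : ℕ, ∀ q : ℕ, 0 < q → ∀ S : Finset SL(2, ℤ),
      (∀ ξ ∈ S, (q : ℤ) ∣ (smul R ξ).a) →
      (∀ ξ ∈ S, ∀ ξ' ∈ S, ξ ≠ ξ' →
        ((ξ' : SL(2, ℤ)) : SL(2, ℤ) ⧸ CongruenceSubgroup.Gamma0 q) ∉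
          MulAction.orbit (stab R) ((ξ : SL(2, ℤ)) : SL(2, ℤ) ⧸ CongruenceSubgroup.Gamma0 q)) →
      ∑ ξ ∈ S, (stabLevel (smul R ξ) q).relIndex (stab (smul R ξ)) ≤ C * (Nat.divisors q).card := by
  obtain ⟨C, hC⟩ := exists_card_levelCosets_le R hA hΔ
  refine ⟨C, fun q hq S hS hdis => le_trans ?_ (hC q hq)⟩
  haveI : NeZero q := ⟨hq.ne'⟩
  classical
  -- orbits as finite sets inside the finite type of cosets
  haveI : Fintype (SL(2, ℤ) ⧸ CongruenceSubgroup.Gamma0 q) := Fintype.ofFinite _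
  set orb : SL(2, ℤ) → Finset (SL(2, ℤ) ⧸ CongruenceSubgroup.Gamma0 q) := fun ξ =>
    (MulAction.orbit (stab R) ((ξ : SL(2, ℤ)) : SL(2, ℤ) ⧸ CongruenceSubgroup.Gamma0 q)).toFinset
    with horb
  have hcard : ∀ ξ : SL(2, ℤ), (stabLevel (smul R ξ) q).relIndex (stab (smul R ξ)) = (orb ξ).card := by
    intro ξ
    rw [index_stabilizer_coset, horb, Set.ncard_eq_toFinset_card']
  simp_rw [hcard]
  -- the orbits of distinct elements of `S` are disjoint
  have hdisj : (S : Set SL(2, ℤ)).PairwiseDisjoint orb := by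
    intro ξ hξ ξ' hξ' hne
    rw [Function.onFun, Finset.disjoint_left]
    intro x hx hx'
    rw [horb, Set.mem_toFinset] at hx hx'
    -- `x` in both orbits forces the orbits, hence the orbit of `ξ'`... to contain `ξ'Γ₀(q)`
    have : ((ξ' : SL(2, ℤ)) : SL(2, ℤ) ⧸ CongruenceSubgroup.Gamma0 q) ∈
        MulAction.orbit (stab R) ((ξ : SL(2, ℤ)) : SL(2, ℤ) ⧸ CongruenceSubgroup.Gamma0 q) := by
      have h1 := MulAction.orbit_eq_iff.2 hx
      have h2 := MulAction.orbit_eq_iff.2 hx'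
      rw [← h1, h2]
      exact MulAction.mem_orbit_self _
    exact hdis ξ hξ ξ' hξ' hne this
  rw [← Finset.card_biUnion hdisj]
  -- the union lies in the level cosets
  calc (S.biUnion orb).card
      ≤ (Finset.univ.filter (fun x => IsLevelCoset R q x)).card := by
        refine Finset.card_le_card fun x hx => ?_
        rw [Finset.mem_biUnion] at hx
        obtain ⟨ξ, hξ, hx⟩ := hx
        rw [horb, Set.mem_toFinset] at hx
        rw [Finset.mem_filter]
        exact ⟨Finset.mem_univ _, orbit_subset_levelCosets R (hS ξ hξ) hx⟩
    _ = Nat.card {x : SL(2, ℤ) ⧸ CongruenceSubgroup.Gamma0 q // IsLevelCoset R q x} :=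
        (Nat.subtype_card _ (fun x => by
          simp only [Finset.mem_filter, Finset.mem_univ, true_and])).symm

end RootForms

end Literature.NumberTheory.Sieve
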